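import Summits.QuantumFields.YangMills.Theorems.BalabanUVNodesStage0FlatWitness
import Literature.MathematicalPhysics.QuantumFieldTheory.Balaban1983to89.T4ContinuumYM4Torus
import Literature.MathematicalPhysics.QuantumFieldTheory.Balaban1983to89.T4BetaFlowWellPosed

/-!
# A FOURTH labelled placeholder in `FiniteEpsData F G`: the ONE-LOOP junk datum — CONSTANT β-functions `β ≡ β₀ > 0`.
# Kernel fact: EVERY β-SIDE BINDER OF THE HEADLINE, and [I] Theorem 2 AS TYPED, holds at a Stage-0 datum of record — trivially

Scope: YM-PLAN Track A bookkeeping (pub-ymgap seat `dag-n23-b`, node N23 = binder B1; tree home of the detail route «BalabanUVNodes» per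
chair R424; filed `--supports stmt-QuantumFields-19181`; bears on binders B3 ∕ B4 ∕ B6 = nodes N25 ∕ N26 ∕ N28 and on the B12-THM2 sub-DAG's
typed statement `B12.Thm2Printed`).  Bookkeeping only; NO analytic content of the series is proved or asserted; nothing of Bałaban's is used.
HONEST FRAMING — READ FIRST: a JUNK inhabitant, labelled field by field, like the flat datum of `BalabanUVNodesStage0FlatWitness` ((B) +
endpoint existence hold trivially; constant flow, β ≡ 0); it differs in the FLOW only: the history-dependent β-functions are the CONSTANT
`β₀ > 0`, so the forward-generated run from the bare coupling `g₀` is the exact one-loop running `1∕g_k² = 1∕g₀² − β₀ k` ([Balaban1987RG1]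
(0.20) with `β_{k+1} ≡ β₀`).  PURPOSE — NEGATIVE INFORMATION, and a CORRECTION of this seat's earlier reading of the flat datum's
`not_logRunning_flat` as «`B12.Thm2Printed` keeps content at Stage 0».  It does NOT: at the one-loop junk datum, AS TYPED, hold
`B12.Thm2Printed D.C.toB12 L` for EVERY `L > 1` (incl. (0.31), `β = β′ = β₀ ∕ log L`; `b12Thm2Printed_oneLoop`), `DagBinding.EndpointExistence`,
binder B3 `FlowStep.BetaPertH D.βfun β₀` (`C = 0`), B4 `BetaContH γ D.βfun` (every γ), B6, `BetaPertHyp`,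
`DagBinding.BetaBoundsInInterval D.C.toB12 γ₀ β₀ β₀` (every γ₀; (1.22)'s window), (B) pinned (flat densities), and the tuned bare couplings are
EXACTLY `g₀ K = (1∕g² + β₀ K)^{−1∕2}` (`tuned_oneLoop_iff`) — an asymptotically-free-LOOKING trajectory whose slope `β₀` is the PROVER's,
unrelated to the vacuum-polarisation second moment (1.20)–(1.22) defining Bałaban's β.  Hence the six-binder headline
`continuumYM4_torus_of_BetaPertH` has B1, B2, B3, B4, B6 JOINTLY inhabited by a junk datum of record (`exists_isDatumOfRecord₀_allBetaBinders`);
its entire Stage-0 content is B5, posed along the junk one-loop trajectory (`hybridNE7Under_oneLoop_iff`).  READING: no BOUND-type clause on β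
excludes the constant function; only PINNING `βfun` to the defined object (NODE 00 ₈b, `Node00/BetaOfRecord`) does (chair R433: pins, not
guards).  One finite T⁴; nothing about `ℝ⁴`, infinite volume, OS axioms, a mass gap or Clay. -/

noncomputable section

open MeasureTheory

namespace Summit.QuantumFields.YangMills.Theorems.BalabanUVNodesStage0OneLoopWitness

open Literature.MathematicalPhysics.QuantumFieldTheory.Balaban1983to89
open Literature.MathematicalPhysics.QuantumFieldTheory.Balaban1983to89.Missing
open Literature.MathematicalPhysics.QuantumFieldTheory.Balaban1983to89.AveragingRT
open Literature.MathematicalPhysics.QuantumFieldTheory.Balaban1983to89.T4Continuum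
open Literature.MathematicalPhysics.QuantumFieldTheory.Balaban1983to89.T4FiniteEpsInhabited
open Summit.QuantumFields.YangMills.Theorems.BalabanUVNodesStage0FlatWitness
open Literature.MathematicalPhysics.QuantumFieldTheory.Balaban1983to89.T4BetaFlowWellPosed (one_div_sqrt_one_div_sq)

/-! ## 1. The one-loop flow: `1∕g_k² = 1∕g₀² − β₀ k` -/

section Flow

variable (β₀ : ℝ)

/-- The CONSTANT history-dependent β-functions `β_{k+1}(g_0, …, g_k) := β₀` — a JUNK family (the printed β_{k+1} is the second moment of a
vacuum-polarisation kernel, [Balaban1987RG1] (1.20)–(1.22), and depends on the history). [folklore] -/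
def constHBeta : FlowStep.HBeta := fun _ _ => β₀

/-- The run's displayed one-variable β-functions: `β_0` unused (`0`), `β_{k+1} ≡ β₀`. [folklore] -/
def constBeta1 : ℕ → ℝ → ℝ
  | 0 => fun _ => 0
  | _ + 1 => fun _ => β₀

/-- The one-loop flow from the bare coupling `g₀`: `g_0 := g₀`, `g_k := (1∕g₀² − β₀ k)^{−1∕2}` for `k ≥ 1` (junk value `0` once the
radicand is `≤ 0`, by `Real.sqrt` of a non-positive number; the forward-generation clause only constrains the positive range). [folklore] -/
def oneLoopG (g₀ : ℝ) : ℕ → ℝ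
  | 0 => g₀
  | k + 1 => 1 / Real.sqrt (1 / g₀ ^ 2 - β₀ * ((k : ℝ) + 1))

/-- `g_{k+1} = 1 ∕ √(1∕g₀² − β₀ (k+1))`. [folklore] -/
theorem oneLoopG_succ (g₀ : ℝ) (k : ℕ) : oneLoopG β₀ g₀ (k + 1) = 1 / Real.sqrt (1 / g₀ ^ 2 - β₀ * ((k : ℝ) + 1)) := rfl

/-- On the positive range the flow is the exact one-loop running: for `g₀ > 0` and `1∕g₀² − β₀ k > 0`,
`g_k = 1∕√(1∕g₀² − β₀ k)`, `g_k > 0` and `1∕g_k² = 1∕g₀² − β₀ k` (also at `k = 0`). [folklore] -/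
theorem oneLoopG_spec {g₀ : ℝ} (hg₀ : 0 < g₀) (k : ℕ) (hr : 0 < 1 / g₀ ^ 2 - β₀ * k) :
    0 < oneLoopG β₀ g₀ k ∧ 1 / (oneLoopG β₀ g₀ k) ^ 2 = 1 / g₀ ^ 2 - β₀ * k := by
  cases k with
  | zero => exact ⟨hg₀, by simp [oneLoopG]⟩
  | succ k =>
    have hr' : 0 < 1 / g₀ ^ 2 - β₀ * ((k : ℝ) + 1) := by simpa using hr
    rw [oneLoopG_succ]
    refine ⟨by positivity, ?_⟩
    rw [one_div_pow, Real.sq_sqrt hr'.le, one_div_one_div]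
    push_cast
    ring

end Flow

/-! ## 2. The one-loop construction, its honest forward generation, its realisation, the one-loop datum -/

section Construction

variable (F : T4Family) (G : Type) [GaugeGroup G] [MeasurableSpace G] [HaarData G] (β₀ : ℝ)
  (av : (K j : ℕ) → Averaging (F.P K) j G)

/-- THE ONE-LOOP CONSTRUCTION (JUNK, labelled in the module docstring): the one-loop flow with constant β; everything else as in the flat
construction (gauge fields as configurations, flat tower as densities, `χ ≡ 0`, `numSites ≡ 0`, zero actions, `Repr ∕ IndAss ∕ Sect2Form :≡ True`). [folklore] -/
def oneLoopConstruction : B16.Construction := fun p =>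
  { flow := ⟨oneLoopG β₀ p.g0, constBeta1 β₀⟩
    Cfg := fun k => GaugeField (F.P p.K) k G
    dom := fun _ => Set.univ
    effAction := fun _ _ => 0
    wilsonBG := fun _ _ => 0
    Ek := fun _ _ => 0
    numSites := fun _ => 0
    Repr := fun _ => True
    IndAss := fun _ => True
    ρ := fun k => flatTower F G p.K p.g0 k
    χ := fun _ _ => 0
    Sect2Form := fun _ => True }

/-- The flow of the run with bare coupling `g₀` is the one-loop flow (`rfl`). [folklore] -/
theorem oneLoop_flow_g (p : B12.RunParams) (k : ℕ) : ((oneLoopConstruction F G β₀).toB12 p).flow.g k = oneLoopG β₀ p.g0 k := rfl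

/-- `CurriesHBeta` holds: both sides are the constant `β₀`. [folklore] -/
theorem curriesHBeta_oneLoop : DagBinding.CurriesHBeta (oneLoopConstruction F G β₀).toB12 (constHBeta β₀) :=
  fun _ _ _ _ => rfl

/-- **The one-loop flow IS generated forward from the bare coupling by the constant β** ([Balaban1987RG1] (0.20) as typed,
`DagBinding.ForwardGenerated`), honestly: `g_0 = g₀`, and if `g_0, …, g_k > 0`, `1∕g_k² − β₀ > 0` then `g_{k+1} > 0`, `1∕g_{k+1}² = 1∕g_k² − β₀`. [folklore] -/
theorem forwardGenerated_oneLoop : DagBinding.ForwardGenerated (oneLoopConstruction F G β₀).toB12 (constHBeta β₀) := by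
  refine ⟨fun _ => rfl, fun p k _ hpos hstep => ?_⟩
  simp only [oneLoop_flow_g] at hpos hstep ⊢
  change 0 < 1 / oneLoopG β₀ p.g0 k ^ 2 - β₀ at hstep
  change 0 < oneLoopG β₀ p.g0 (k + 1) ∧ 1 / oneLoopG β₀ p.g0 (k + 1) ^ 2 = 1 / oneLoopG β₀ p.g0 k ^ 2 - β₀
  have hg₀ : 0 < p.g0 := hpos 0 (Nat.zero_le _)
  have hk : 0 < 1 / p.g0 ^ 2 - β₀ * k ∧ 1 / (oneLoopG β₀ p.g0 k) ^ 2 = 1 / p.g0 ^ 2 - β₀ * k := by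
    induction k with
    | zero => exact ⟨by simpa using pow_pos hg₀ 2, by simp [oneLoopG]⟩
    | succ j ih =>
      have hposj : ∀ i, i ≤ j → 0 < oneLoopG β₀ p.g0 i := fun i hi => hpos i (hi.trans (Nat.le_succ j))
      have hgj1 : 0 < oneLoopG β₀ p.g0 (j + 1) := hpos (j + 1) le_rfl
      have hr : 0 < 1 / p.g0 ^ 2 - β₀ * ((j : ℝ) + 1) := by
        by_contra hle
        replace hle := not_lt.mp hle
        have : oneLoopG β₀ p.g0 (j + 1) = 0 := by
          rw [oneLoopG_succ, Real.sqrt_eq_zero'.mpr hle, div_zero]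
        exact hgj1.ne' this
      have hr' : 0 < 1 / p.g0 ^ 2 - β₀ * ((j + 1 : ℕ) : ℝ) := by simpa using hr
      exact ⟨hr', (oneLoopG_spec β₀ hg₀ (j + 1) hr').2⟩
  have hr1 : 0 < 1 / p.g0 ^ 2 - β₀ * ((k + 1 : ℕ) : ℝ) := by
    rw [hk.2] at hstep; push_cast; linarith
  obtain ⟨hpos1, heq1⟩ := oneLoopG_spec β₀ hg₀ (k + 1) hr1
  refine ⟨hpos1, ?_⟩
  rw [heq1, hk.2]; push_cast; ring

variable [RegularGaugeGroup G]

/-- THE ONE-LOOP REALISATION — verbatim the flat realisation (the densities do not read the flow): identity dictionary, Boltzmann start,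
honest Radon–Nikodym transport, `R :=` flattening, `ρ_{k+1} = R(Tρ_k)` because `∫Tρ_k = ∫ρ_k = Z_ε`. [folklore] -/
def oneLoopRealisation (hmeas : ∀ K j, Measurable (av K j).avg) (hac : ∀ K k, k < K → HaarAC (av K k).avg) :
    Realisation F G (oneLoopConstruction F G β₀) av where
  cfg := fun _ _ _ => Equiv.refl _
  rho_zero := fun _ _ => ⟨1, one_pos, fun _ => (one_mul _).symm⟩
  Trho := fun K g₀ k => rnTransport (av K k).avg (flatTower F G K g₀ k)
  isRT_Trho := fun K g₀ k hk =>
    isRT_rnTransport_of_ac _ (hmeas K k) (hac K k hk) _ (integrable_flatTower F G K g₀ k)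
  R := fun _ _ _ => flatten
  preservesIntegral_R := fun _ _ _ _ => preservesIntegral_flatten
  rho_succ_eq := fun K g₀ k hk => by
    funext V
    show partitionFn (G := G) (F.P K) (g₀⁻¹ ^ 2) =
      ∫ W, rnTransport (av K k).avg (flatTower F G K g₀ k) W ∂fieldMeasure (F.P K) (k + 1) G
    have h := isRT_rnTransport_of_ac _ (hmeas K k) (hac K k hk) _ (integrable_flatTower F G K g₀ k)
      (fun _ => (1 : ℝ)) measurable_const ⟨1, fun _ => by simp⟩
    simp only [mul_one] at h
    rw [h, integral_flatTower]

/-- THE ONE-LOOP DATUM: finite-`ε` data with the GIVEN averagings on the one-loop construction — a labelled JUNK inhabitant. [folklore] -/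
def oneLoopData (hmeas : ∀ K j, Measurable (av K j).avg) (hac : ∀ K k, k < K → HaarAC (av K k).avg) : FiniteEpsData F G where
  C := oneLoopConstruction F G β₀
  βfun := constHBeta β₀
  curries := curriesHBeta_oneLoop F G β₀
  fwd := forwardGenerated_oneLoop F G β₀
  av := av
  real := oneLoopRealisation F G β₀ av hmeas hac

end Construction

/-! ## 3. What holds at the one-loop construction, AS TYPED -/

section JunkTrue

variable (F : T4Family) (G : Type) [GaugeGroup G] [MeasurableSpace G] [HaarData G]

/-- THE ONE-LOOP TUNING aimed at `g` after `K` steps: `g₀ := (1∕g² + β₀ K)^{−1∕2}`. [folklore] -/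
def tuneG (β₀ g : ℝ) (K : ℕ) : ℝ := 1 / Real.sqrt (1 / g ^ 2 + β₀ * K)

/-- `g₀ > 0` and `1∕g₀² = 1∕g² + β₀ K`. [folklore] -/
theorem tuneG_spec {β₀ : ℝ} (hβ₀ : 0 < β₀) {g : ℝ} (hg : 0 < g) (K : ℕ) :
    0 < tuneG β₀ g K ∧ 1 / (tuneG β₀ g K) ^ 2 = 1 / g ^ 2 + β₀ * K := by
  have hR : 0 < 1 / g ^ 2 + β₀ * K := by positivity
  refine ⟨by unfold tuneG; positivity, ?_⟩
  rw [tuneG, one_div_pow, Real.sq_sqrt hR.le, one_div_one_div]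

/-- Along the tuned one-loop run: for `k ≤ K`, `g_k > 0`, `1∕g_k² = 1∕g² + β₀ (K − k)` and `g_k ≤ g`. [folklore] -/
theorem oneLoop_run {β₀ : ℝ} (hβ₀ : 0 < β₀) {g : ℝ} (hg : 0 < g) (K k : ℕ) (hk : k ≤ K) :
    0 < oneLoopG β₀ (tuneG β₀ g K) k ∧
      1 / (oneLoopG β₀ (tuneG β₀ g K) k) ^ 2 = 1 / g ^ 2 + β₀ * ((K : ℝ) - k) ∧
      oneLoopG β₀ (tuneG β₀ g K) k ≤ g := by
  obtain ⟨hg₀, hg₀sq⟩ := tuneG_spec hβ₀ hg K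
  have hkK : (k : ℝ) ≤ K := by exact_mod_cast hk
  have hg2 : 0 < 1 / g ^ 2 := by positivity
  have hr : 0 < 1 / (tuneG β₀ g K) ^ 2 - β₀ * k := by
    rw [hg₀sq]; nlinarith [mul_le_mul_of_nonneg_left hkK hβ₀.le]
  obtain ⟨hpos, heq⟩ := oneLoopG_spec β₀ hg₀ k hr
  have heq' : 1 / (oneLoopG β₀ (tuneG β₀ g K) k) ^ 2 = 1 / g ^ 2 + β₀ * ((K : ℝ) - k) := by rw [heq, hg₀sq]; ring
  refine ⟨hpos, heq', ?_⟩
  have hge : 1 / g ^ 2 ≤ 1 / (oneLoopG β₀ (tuneG β₀ g K) k) ^ 2 := by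
    rw [heq']; nlinarith [mul_le_mul_of_nonneg_left hkK hβ₀.le]
  have h1 := (one_div_le_one_div (pow_pos hg 2) (pow_pos hpos 2)).mp hge
  nlinarith [hpos, hg, h1]

/-- The tuned one-loop run ENDS at `g`: `g_K = g`. [folklore] -/
theorem oneLoop_end {β₀ : ℝ} (hβ₀ : 0 < β₀) {g : ℝ} (hg : 0 < g) (K : ℕ) : oneLoopG β₀ (tuneG β₀ g K) K = g := by
  obtain ⟨_, hg₀sq⟩ := tuneG_spec hβ₀ hg K
  cases K with
  | zero =>
    show tuneG β₀ g 0 = g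
    rw [tuneG, show (1 : ℝ) / g ^ 2 + β₀ * ((0 : ℕ) : ℝ) = 1 / g ^ 2 by simp]
    exact one_div_sqrt_one_div_sq hg
  | succ j =>
    rw [oneLoopG_succ, hg₀sq, show (1 : ℝ) / g ^ 2 + β₀ * ((j + 1 : ℕ) : ℝ) - β₀ * ((j : ℝ) + 1) = 1 / g ^ 2 by
      push_cast; ring]
    exact one_div_sqrt_one_div_sq hg

/-- **ENDPOINT EXISTENCE AS TYPED HOLDS AT THE ONE-LOOP CONSTRUCTION** (`DagBinding.EndpointExistence`, the endpoint half of
[Balaban1987RG1] Thm 2 p. 259): from `g₀ := (1∕g² + β₀ K)^{−1∕2}` the run stays in `]0, γ]` and ends at `g_K = g`. [folklore] -/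
theorem endpointExistence_oneLoop {β₀ : ℝ} (hβ₀ : 0 < β₀) : DagBinding.EndpointExistence (oneLoopConstruction F G β₀).toB12 := fun _ =>
  ⟨1, one_pos, fun γ hγ _ => ⟨γ, hγ, fun g hg hgγ K => ⟨tuneG β₀ g K, fun k hk => by
    rw [oneLoop_flow_g]
    exact ⟨(oneLoop_run hβ₀ hg K k hk).1, (oneLoop_run hβ₀ hg K k hk).2.2.trans hgγ⟩, by
    rw [oneLoop_flow_g]
    exact oneLoop_end hβ₀ hg K⟩⟩⟩

/-- **[Balaban1987RG1] THEOREM 2 AS TYPED (`B12.Thm2Printed`, INCLUDING the logarithmic running (0.31)) HOLDS AT THE ONE-LOOP CONSTRUCTION**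
for EVERY `L > 1`: with `β = β′ := β₀ ∕ log L` the run from `(1∕g² + β₀ K)^{−1∕2}` has `1∕g_k² = 1∕g² + β (K − k) log L` EXACTLY — a
bound-type clause does not exclude the constant β-function. [folklore] -/
theorem b12Thm2Printed_oneLoop {β₀ : ℝ} (hβ₀ : 0 < β₀) {L : ℝ} (hL : 1 < L) : B12.Thm2Printed (oneLoopConstruction F G β₀).toB12 L := by
  have hlog : 0 < Real.log L := Real.log_pos hL
  intro _
  refine ⟨1, one_pos, fun γ hγ _ => ⟨γ, hγ, fun g hg hgγ => ⟨β₀ / Real.log L, β₀ / Real.log L, div_pos hβ₀ hlog, le_rfl,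
    fun K => ⟨tuneG β₀ g K, fun k hk => ?_, ?_, fun k hk => ?_⟩⟩⟩⟩
  · rw [oneLoop_flow_g]
    exact ⟨(oneLoop_run hβ₀ hg K k hk).1, (oneLoop_run hβ₀ hg K k hk).2.2.trans hgγ⟩
  · rw [oneLoop_flow_g]
    exact oneLoop_end hβ₀ hg K
  · rw [oneLoop_flow_g, (oneLoop_run hβ₀ hg K k hk).2.1,
      show β₀ / Real.log L * (((K : ℝ) - k) * Real.log L) = β₀ * ((K : ℝ) - k) by field_simp]
    exact ⟨le_rfl, le_rfl⟩

/-- [Balaban1989LargeFieldII] Thm 1 AS TYPED holds at the one-loop construction (`Sect2Form :≡ True`). [folklore] -/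
theorem thm1Printed_oneLoop (β₀ : ℝ) : B16.Thm1Printed (oneLoopConstruction F G β₀) :=
  ⟨1, one_pos, fun _ _ _ _ => trivial⟩

/-- **THE β-WINDOW OF [Balaban1987RG1] (1.22) AS TYPED (`DagBinding.BetaBoundsInInterval`) HOLDS at the one-loop construction with `b = b′ = β₀`,
for EVERY `γ₀`** — the displayed `β_{j+1}` are the constant `β₀`. [folklore] -/
theorem betaBoundsInInterval_oneLoop (β₀ γ₀ : ℝ) :
    DagBinding.BetaBoundsInInterval (oneLoopConstruction F G β₀).toB12 γ₀ β₀ β₀ :=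
  fun _ _ _ _ _ _ _ => ⟨le_rfl, le_rfl⟩

/-- **BINDER B3 AS TYPED (`FlowStep.BetaPertH D.βfun β̄`, the scoping note's RIGID one-loop form) HOLDS for the constant β** with `β̄ := β₀`,
constant `C := 0`. [folklore] -/
theorem betaPertH_const (β₀ : ℝ) : FlowStep.BetaPertH (constHBeta β₀) β₀ :=
  ⟨1, one_pos, 0, le_rfl, fun _ _ _ _ _ _ => by simp [constHBeta]⟩

/-- **BINDER B4 AS TYPED (`FlowStep.BetaContH γ D.βfun`) HOLDS for the constant β**, every `γ`. [folklore] -/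
theorem betaContH_const (β₀ γ : ℝ) : FlowStep.BetaContH γ (constHBeta β₀) := fun _ => continuousOn_const

/-- The packaged β-input `T4Continuum.BetaPertHyp` (B3 ∧ B4 ∧ B6) holds for the constant β. [folklore] -/
theorem betaPertHyp_const {β₀ : ℝ} (hβ₀ : 0 < β₀) : BetaPertHyp (constHBeta β₀) :=
  ⟨⟨β₀, hβ₀, betaPertH_const β₀⟩, 1, one_pos, betaContH_const β₀ 1⟩

variable [RegularGaugeGroup G]

/-- [Balaban1988Convergent] Cor. 3 (2.50) AS TYPED holds at the one-loop construction with `e₋ = e₊ ≡ 0` (`χ ≡ 0`; `0 ≤ ρ_k ≤ 1`). [folklore] -/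
theorem cor3_250_oneLoop (β₀ : ℝ) : B16.Cor3_250 (oneLoopConstruction F G β₀) := by
  refine ⟨1, one_pos, fun _ => 0, fun _ => 0, fun P _ k _ V => ⟨?_, ?_⟩⟩
  · show (0 : ℝ) * _ ≤ flatTower F G P.K P.g0 k V
    rw [zero_mul]
    exact flatTower_nonneg F G P.K P.g0 k V
  · show flatTower F G P.K P.g0 k V ≤ Real.exp (0 * ((0 : ℕ) : ℝ))
    rw [zero_mul, Real.exp_zero]
    exact flatTower_le_one F G P.K P.g0 k V

/-- **(B) PINNED AS TYPED HOLDS AT THE ONE-LOOP CONSTRUCTION.** [folklore] -/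
theorem endStatementBPrinted_oneLoop (β₀ : ℝ) : B16.EndStatementBPrinted (oneLoopConstruction F G β₀) :=
  ⟨thm1Printed_oneLoop F G β₀, cor3_250_oneLoop F G β₀⟩

variable (av : (K j : ℕ) → Averaging (F.P K) j G)

/-- **THE TUNED BARE COUPLINGS OF THE ONE-LOOP DATUM**: for `0 < g ≤ γ`, `D.Tuned γ g g₀ ↔ ∀ K, g₀ K = (1∕g² + β₀ K)^{−1∕2}` — the
renormalisation conditions of [Balaban1987RG1] Thm 2 select EXACTLY the one-loop tuning with the prover's slope `β₀`. [folklore] -/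
theorem tuned_oneLoop_iff {β₀ : ℝ} (hβ₀ : 0 < β₀) (hmeas : ∀ K j, Measurable (av K j).avg)
    (hac : ∀ K k, k < K → HaarAC (av K k).avg) {γ g : ℝ} (hg : 0 < g) (hgγ : g ≤ γ) (g₀ : ℕ → ℝ) :
    (oneLoopData F G β₀ av hmeas hac).Tuned γ g g₀ ↔ ∀ K, g₀ K = tuneG β₀ g K := by
  constructor
  · intro h K
    obtain ⟨hI, hK⟩ := h K
    change (∀ k, k ≤ K → 0 < oneLoopG β₀ (g₀ K) k ∧ oneLoopG β₀ (g₀ K) k ≤ γ) at hI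
    change oneLoopG β₀ (g₀ K) K = g at hK
    have hg₀ : 0 < g₀ K := by simpa [oneLoopG] using (hI 0 (Nat.zero_le _)).1
    have hrun : ∀ k, k ≤ K → 0 < 1 / g₀ K ^ 2 - β₀ * k ∧ 1 / (oneLoopG β₀ (g₀ K) k) ^ 2 = 1 / g₀ K ^ 2 - β₀ * k := by
      intro k hk
      induction k with
      | zero => exact ⟨by simpa using pow_pos hg₀ 2, by simp [oneLoopG]⟩
      | succ j _ =>
        have hgj1 : 0 < oneLoopG β₀ (g₀ K) (j + 1) := (hI (j + 1) hk).1
        have hr : 0 < 1 / g₀ K ^ 2 - β₀ * ((j : ℝ) + 1) := by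
          by_contra hle
          replace hle := not_lt.mp hle
          have : oneLoopG β₀ (g₀ K) (j + 1) = 0 := by
            rw [oneLoopG_succ, Real.sqrt_eq_zero'.mpr hle, div_zero]
          exact hgj1.ne' this
        have hr' : 0 < 1 / g₀ K ^ 2 - β₀ * ((j + 1 : ℕ) : ℝ) := by simpa using hr
        exact ⟨hr', (oneLoopG_spec β₀ hg₀ (j + 1) hr').2⟩
    obtain ⟨-, heqK⟩ := hrun K le_rfl
    rw [hK] at heqK
    have hsq : 1 / g₀ K ^ 2 = 1 / g ^ 2 + β₀ * K := by linarith
    rw [tuneG, ← hsq]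
    exact (one_div_sqrt_one_div_sq hg₀).symm
  · intro h K
    rw [h K]
    refine ⟨fun k hk => ?_, ?_⟩
    · change 0 < oneLoopG β₀ _ k ∧ oneLoopG β₀ _ k ≤ γ
      exact ⟨(oneLoop_run hβ₀ hg K k hk).1, (oneLoop_run hβ₀ hg K k hk).2.2.trans hgγ⟩
    · change oneLoopG β₀ _ K = g
      exact oneLoop_end hβ₀ hg K

/-- Tuned sequences force `g ≤ γ`. [folklore] -/
theorem le_of_tuned_oneLoop {β₀ : ℝ} (hmeas : ∀ K j, Measurable (av K j).avg) (hac : ∀ K k, k < K → HaarAC (av K k).avg)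
    {γ g : ℝ} {g₀ : ℕ → ℝ} (h : (oneLoopData F G β₀ av hmeas hac).Tuned γ g g₀) : g ≤ γ := by
  obtain ⟨hI, hK⟩ := h 0
  have := (hI 0 le_rfl).2
  change oneLoopG β₀ (g₀ 0) 0 ≤ γ at this; change oneLoopG β₀ (g₀ 0) 0 = g at hK; rwa [hK] at this

end JunkTrue

/-! ## 4. At `SU(N)` with the averaging of record: ALL β-side binders + (B) + [I] Thm 2 as typed, at one Stage-0 datum of record -/

section Record

open Literature.MathematicalPhysics.QuantumFieldTheory.Balaban1983to89.Node00

variable (F : T4Family) (N : ℕ) [NeZero N]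

/-- THE ONE-LOOP DATUM OF RECORD (Stage 0): the one-loop datum driven by Bałaban's averaging of record on `SU(N)`.  JUNK beyond `av`. [folklore] -/
def oneLoopDatumSU (β₀ : ℝ) : FiniteEpsData F (Matrix.specialUnitaryGroup (Fin N) ℂ) :=
  oneLoopData F (Matrix.specialUnitaryGroup (Fin N) ℂ) β₀ (avOfRecord F N) (avOfRecord_measurable F N) (avOfRecord_haarAC F N)

/-- It IS a datum of record, Stage 0 (`rfl`). [folklore] -/
theorem isDatumOfRecord₀_oneLoopDatumSU (β₀ : ℝ) : IsDatumOfRecord₀ F N (oneLoopDatumSU F N β₀) := rfl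

/-- **KERNEL WITNESS №4 — EVERY β-SIDE BINDER, (B) AND [I] THM 2 AS TYPED AT ONE STAGE-0 DATUM OF RECORD**: on every family, every `N ≥ 1`,
for every slope `β₀ > 0`, the one-loop junk datum is a datum of record (Stage 0) at which hold, as typed: B1, B2 (`B16.EndStatementBPrinted`),
B3 (`BetaPertH D.βfun β₀`), B4 (`BetaContH γ D.βfun`, every γ), `BetaPertHyp`, endpoint existence, `B12.Thm2Printed D.C.toB12 L` for every
`L > 1`, and the β-window `BetaBoundsInInterval D.C.toB12 γ₀ β₀ β₀` for every `γ₀`.  NEGATIVE INFORMATION: none of these typed statements,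
alone or jointly, expresses anything about Bałaban's β-functions at Stage 0. [folklore] -/
theorem exists_isDatumOfRecord₀_allBetaBinders {β₀ : ℝ} (hβ₀ : 0 < β₀) {L : ℝ} (hL : 1 < L) :
    ∃ D : FiniteEpsData F (Matrix.specialUnitaryGroup (Fin N) ℂ), IsDatumOfRecord₀ F N D ∧ D.IsPrintedAveraged ∧
      B16.EndStatementBPrinted D.C ∧ FlowStep.BetaPertH D.βfun β₀ ∧ (∀ γ, FlowStep.BetaContH γ D.βfun) ∧ BetaPertHyp D.βfun ∧
      DagBinding.EndpointExistence D.C.toB12 ∧ B12.Thm2Printed D.C.toB12 L ∧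
      ∀ γ₀, DagBinding.BetaBoundsInInterval D.C.toB12 γ₀ β₀ β₀ :=
  ⟨oneLoopDatumSU F N β₀, rfl, isPrintedAveraged_of_isDatumOfRecord₀ F N _ rfl,
    endStatementBPrinted_oneLoop F _ β₀, betaPertH_const β₀, fun γ => betaContH_const β₀ γ,
    betaPertHyp_const hβ₀, endpointExistence_oneLoop F _ hβ₀,
    b12Thm2Printed_oneLoop F _ hβ₀ hL, fun γ₀ => betaBoundsInInterval_oneLoop F _ β₀ γ₀⟩

/-- **THE SIX-BINDER HEADLINE AT THE ONE-LOOP DATUM, UNFOLDED**: binders B1–B4, B6 hold there (above), and binder B5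
`HybridNE7Under D (BetaPertHyp D.βfun)` is EQUIVALENT to «for all small `γ`, `g ≤ γ`: per-string hybrid-NE7 data for the Wilson scheme of record
along the one-loop tuning `tuneG β₀ g K = (1∕g² + β₀ K)^{−1∕2}`» — the prover's slope, not (1.20)–(1.22)'s second moment. [folklore] -/
theorem hybridNE7Under_oneLoop_iff {β₀ : ℝ} (hβ₀ : 0 < β₀) :
    T4ApexHybrid.HybridNE7Under (oneLoopDatumSU F N β₀) (BetaPertHyp (oneLoopDatumSU F N β₀).βfun) ↔
      ∃ γ₀ : ℝ, 0 < γ₀ ∧ ∀ γ : ℝ, 0 < γ → γ ≤ γ₀ → ∃ g₁ : ℝ, 0 < g₁ ∧ ∀ g : ℝ, 0 < g → g ≤ g₁ → g ≤ γ →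
        T4ApexHybrid.StringwiseHybridNE7 ((oneLoopDatumSU F N β₀).scheme (tuneG β₀ g)) := by
  have hB := endStatementBPrinted_oneLoop F (Matrix.specialUnitaryGroup (Fin N) ℂ) β₀
  have hH : BetaPertHyp (oneLoopDatumSU F N β₀).βfun := betaPertHyp_const hβ₀
  have htuned : ∀ {γ g : ℝ}, 0 < g → g ≤ γ → ∀ g₀ : ℕ → ℝ,
      (oneLoopDatumSU F N β₀).Tuned γ g g₀ ↔ ∀ K, g₀ K = tuneG β₀ g K := fun hg hgγ g₀ =>
    tuned_oneLoop_iff F _ (avOfRecord F N) hβ₀ (avOfRecord_measurable F N) (avOfRecord_haarAC F N) hg hgγ g₀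
  unfold T4ApexHybrid.HybridNE7Under
  rw [T4ContinuumYM4Torus.underHypotheses_iff]
  constructor
  · intro h
    obtain ⟨γ₀, hγ₀, hγ⟩ := h hB hH
    refine ⟨γ₀, hγ₀, fun γ hγpos hγle => ?_⟩
    obtain ⟨g₁, hg₁, hg⟩ := hγ γ hγpos hγle
    exact ⟨g₁, hg₁, fun g hgpos hgle hgγ => hg g hgpos hgle _ ((htuned hgpos hgγ _).mpr fun _ => rfl)⟩
  · intro h _ _
    obtain ⟨γ₀, hγ₀, hγ⟩ := h
    refine ⟨γ₀, hγ₀, fun γ hγpos hγle => ?_⟩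
    obtain ⟨g₁, hg₁, hg⟩ := hγ γ hγpos hγle
    refine ⟨g₁, hg₁, fun g hgpos hgle g₀ ht => ?_⟩
    have hgγ : g ≤ γ :=
      le_of_tuned_oneLoop F _ (avOfRecord F N) (avOfRecord_measurable F N) (avOfRecord_haarAC F N) ht
    have hg₀ : g₀ = tuneG β₀ g := funext ((htuned hgpos hgγ g₀).mp ht)
    rw [hg₀]
    exact hg g hgpos hgle hgγ

end Record

end Summit.QuantumFields.YangMills.Theorems.BalabanUVNodesStage0OneLoopWitness

end
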